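import Summits.RiemannHypothesis.RiemannHypothesis.Theorems.JensenPolynomialsLogBandDerivZerosReBound
import Summits.RiemannHypothesis.RiemannHypothesis.Theorems.JensenPolynomialsChainDefs
import Literature.NumberTheory.LFunctions.RiemannHypothesisUpTo10000EM
import Literature.NumberTheory.LFunctions.RiemannHypothesisUpTo100000X
import HarnessLib

/-!
# Zeros of `ξ₁⁽ⁿ⁾` below the verified height: the chain root, and the band EDGE for `n ≤ 9800`

Support file for crux `XiDerivEdgeReal` (stmt-RiemannHypothesis-19912) of route «JensenLogBand»
(rh-jensen-idea-2 g6 text, landed by g7; negation lens, chain-root dictionary). RH-FREE throughout.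
bears_on: LADDER-RH J-P(P3). Content:

* `exists_root_of_iteratedDeriv_xiSq_eq_zero_of_im_pos` — every zero `w` of `ξ₁⁽ⁿ⁾ = iteratedDeriv n xiSq`
  with `Im w > 0` has a CHAIN ROOT: a zero `z₀` of `ξ₁` with `Im w ≤ Im z₀`, `‖z₀ − w‖ ≤ (1+√n)·Im z₀`,
  `√‖z₀‖ ≤ 1 + √n + √‖w‖` (backward Jensen chain, `exists_jensen_chain` + `chain_variation_le`);
* `exists_offLine_zeta_zero_of_iteratedDeriv_xiSq_eq_zero_of_im_pos` — hence an OFF-LINE zero `ρ` of `ζ`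
  (`Re ρ ≠ ½`) with `|Im ρ| ≤ 1 + √n + √‖w‖`;
* `im_eq_zero_of_iteratedDeriv_xiSq_eq_zero_of_rhUpTo` — `RiemannHypothesisUpTo H` makes every zero of
  every `ξ₁⁽ⁿ⁾` with `1 + √n + √‖w‖ ≤ H` real; instances `H = 10⁴` (unconditional, tree
  `riemannHypothesisUpTo_10000`) and `H = 10⁵` (unconditional, tree `riemannHypothesisUpTo_100000` of
  `RiemannHypothesisUpTo100000X`, Riemann–Siegel certificate with the PROVED remainder bound);
* `edgeReal_upTo_9800` — the EDGE statement of crux `JensenLogBand.XiDerivEdgeReal` (zeros of `ξ₁⁽ⁿ⁾` in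
  `‖z‖ ≤ 64 (n / log n)²` are real) holds for EVERY `n ≤ 9800` and (`edgeReal_upTo_130000`) for every
  `n ≤ 130000`, unconditionally; `bandReal_of_rhUpTo`, `edgeReal_of_rhUpTo_of_le` for any verified height;
* `xiDerivEdgeReal_rung` — the crux's own matrix (`chainRadius n ≤ ‖z‖ ≤ 64 (n/log n)² ⇒ Im z = 0`) with
  the quantifier `n₁ ≤ n` replaced by the finite range `n ≤ 130000`: a proved FIRST RUNG (BC5/T3 witness)
  of `XiDerivEdgeReal`. Why it lies outside S's known regime: the crux (and the rung leaf
  `JensenLogBandEighth`) are statements for all LARGE `n`; no asymptotic/saddle method in the tree or in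
  print decides EDGE at any finite `n`, and the rung is powered by the tree's kernel-certified numerical
  `RiemannHypothesisUpTo 100000` through the chain-root dictionary — it certifies the EDGE annulus at every
  level `n ≤ 130000` (heights `√‖z‖ ≤ 8n/log n ≤ 88300`), a region no closed item covers. Honest flag: the
  rung is numerical-RH powered (`computational`: compiled sign certificates) and does not exercise the
  route's saddle lever.

WHAT THIS IS NOT: a statement about zeros of `ζ` off the critical line; it certifies zeros of
derivatives of `ξ₁` in explicit discs from the tree's numerical RH, nothing about RH itself.
-/

set_option linter.dupNamespace false

noncomputable section

open Complex Filter Metric Set Topology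
open scoped ComplexConjugate

namespace Summit.RiemannHypothesis.RiemannHypothesis.Theorems.JensenPolynomials.LogBand.VerifiedHeight

open Literature.NumberTheory.LFunctions Literature.Analysis.Complex
  Literature.Barriers.RiemannHypothesis Literature.NumberTheory.DiophantineGeometry
  Summit.RiemannHypothesis.RiemannHypothesis.Theorems.JensenPolynomials
  Summit.RiemannHypothesis.RiemannHypothesis.Theorems.JensenPolynomials.EffectiveKimLee
  Summit.RiemannHypothesis.RiemannHypothesis.Theorems.JensenPolynomials.LogBand

/-! ### A.1 The root of a Jensen chain -/

/-- **Chain root (upper half-plane).** A zero `w` of `ξ₁⁽ⁿ⁾` with `Im w > 0` descends from a zero `z₀`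
of `ξ₁` with `0 < Im w ≤ Im z₀`, `‖z₀ − w‖ ≤ (1 + √n)·Im z₀` and `√‖z₀‖ ≤ 1 + √n + √‖w‖`.
(Tree: `exists_jensen_chain`, `chain_variation_le`, `abs_im_le_sqrt_norm_of_xiSq_eq_zero`.) RH-FREE. -/
theorem exists_root_of_iteratedDeriv_xiSq_eq_zero_of_im_pos (n : ℕ) {w : ℂ}
    (hw : iteratedDeriv n xiSq w = 0) (him : 0 < w.im) :
    ∃ z₀ : ℂ, xiSq z₀ = 0 ∧ 0 < z₀.im ∧ w.im ≤ z₀.im ∧ ‖z₀ - w‖ ≤ (1 + Real.sqrt n) * z₀.im ∧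
      Real.sqrt ‖z₀‖ ≤ 1 + Real.sqrt n + Real.sqrt ‖w‖ := by
  obtain ⟨C, hC⟩ := norm_xiSq_le
  obtain ⟨z, hzn, hzero, hpos, hrel⟩ := exists_jensen_chain differentiable_xiSq
    (by norm_num : (0 : ℝ) ≤ 7 / 8) (by norm_num : (7 / 8 : ℝ) < 2) hC im_xiSq_ofReal
    iteratedDeriv_xiSq_ne_zero n him hw
  set s : ℝ := 1 + Real.sqrt n with hs
  have hs0 : 0 ≤ s := by have := Real.sqrt_nonneg (n : ℝ); rw [hs]; linarith
  set V : ℝ := ∑ k ∈ Finset.range n, ‖z k - z (k + 1)‖ with hV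
  have hVle : V ≤ (z 0).im * (1 + Real.sqrt n) := chain_variation_le hpos hrel
  have hz0w : ‖z 0 - z n‖ ≤ V := by
    have h := dist_le_Ico_sum_dist z (Nat.zero_le n)
    rw [dist_eq_norm] at h
    refine h.trans (le_of_eq ?_)
    rw [hV, Finset.range_eq_Ico]
    simp only [dist_eq_norm]
  rw [hzn] at hz0w
  have hnorm0 : ‖z 0‖ ≤ ‖w‖ + V := by
    calc ‖z 0‖ = ‖(z 0 - w) + w‖ := by rw [sub_add_cancel]
      _ ≤ ‖z 0 - w‖ + ‖w‖ := norm_add_le _ _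
      _ ≤ V + ‖w‖ := by linarith
      _ = ‖w‖ + V := add_comm _ _
  have hroot : xiSq (z 0) = 0 := by simpa using hzero 0 (Nat.zero_le _)
  set y : ℝ := (z 0).im with hy
  have hy0 : 0 < y := hpos 0 (Nat.zero_le _)
  have hy1 : y ≤ Real.sqrt (‖w‖ + V) := by
    have h1 : |(z 0).im| ≤ Real.sqrt ‖z 0‖ := abs_im_le_sqrt_norm_of_xiSq_eq_zero hroot
    rw [abs_of_pos hy0] at h1
    exact h1.trans (Real.sqrt_le_sqrt hnorm0)
  have hy2 : y ^ 2 ≤ ‖w‖ + s * y := by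
    have h1 : y ^ 2 ≤ ‖w‖ + V := by
      calc y ^ 2 ≤ Real.sqrt (‖w‖ + V) ^ 2 := pow_le_pow_left₀ hy0.le hy1 2
        _ = ‖w‖ + V := Real.sq_sqrt (by positivity)
    have h2 : V ≤ s * y := by rw [hs, mul_comm]; exact hVle
    linarith
  have hy3 : y ≤ s + Real.sqrt ‖w‖ := le_add_sqrt_of_sq_le hs0 (norm_nonneg w) hy2
  -- monotonicity of the imaginary parts along the chain: `Im w = Im z n ≤ Im z 0`
  have him_step : ∀ k < n, (z (k + 1)).im ≤ (z k).im := fun k hk ↦ by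
    have h := hrel k hk
    have h1 := hpos (k + 1) hk
    have h2 := hpos k hk.le
    nlinarith [sq_nonneg ((z (k + 1)).re - (z k).re)]
  have him_chain : ∀ k ≤ n, (z k).im ≤ (z 0).im := by
    intro k hk
    induction k with
    | zero => exact le_rfl
    | succ k ih => exact (him_step k (Nat.lt_of_succ_le hk)).trans (ih (Nat.le_of_succ_le hk))
  have hwim : w.im ≤ y := by have := him_chain n le_rfl; rwa [hzn] at this
  -- `√‖z₀‖ ≤ 1 + √n + √‖w‖`: from `‖z₀‖ ≤ ‖w‖ + s y ≤ ‖w‖ + s (s + √‖w‖) ≤ (s + √‖w‖)²`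
  have hsq : ‖z 0‖ ≤ (s + Real.sqrt ‖w‖) ^ 2 := by
    have h2 : V ≤ s * y := by rw [hs, mul_comm]; exact hVle
    have hw0 : (Real.sqrt ‖w‖) ^ 2 = ‖w‖ := Real.sq_sqrt (norm_nonneg w)
    nlinarith [mul_le_mul_of_nonneg_left hy3 hs0, Real.sqrt_nonneg ‖w‖]
  have hroot_norm : Real.sqrt ‖z 0‖ ≤ s + Real.sqrt ‖w‖ := by
    calc Real.sqrt ‖z 0‖ ≤ Real.sqrt ((s + Real.sqrt ‖w‖) ^ 2) := Real.sqrt_le_sqrt hsq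
      _ = s + Real.sqrt ‖w‖ := Real.sqrt_sq (by positivity)
  refine ⟨z 0, hroot, hy0, hwim, ?_, by rw [hs] at hroot_norm; linarith⟩
  calc ‖z 0 - w‖ ≤ V := hz0w
    _ ≤ y * (1 + Real.sqrt n) := hVle
    _ = (1 + Real.sqrt n) * y := mul_comm _ _

/-- **The ancestor is an OFF-LINE zero of `ζ`.** A zero `w` of `ξ₁⁽ⁿ⁾` with `Im w > 0` forces a zero
`ρ` of `ζ` in the critical strip OFF the critical line with `0 < |Im ρ|` and
`|Im ρ| ≤ |ρ − ½| ≤ 1 + √n + √‖w‖`. RH-FREE (under RH the hypothesis is never met). -/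
theorem exists_offLine_zeta_zero_of_iteratedDeriv_xiSq_eq_zero_of_im_pos (n : ℕ) {w : ℂ}
    (hw : iteratedDeriv n xiSq w = 0) (him : 0 < w.im) :
    ∃ ρ : ℂ, riemannZeta ρ = 0 ∧ 0 < ρ.re ∧ ρ.re < 1 ∧ ρ.re ≠ 1 / 2 ∧ ρ.im ≠ 0 ∧
      |ρ.im| ≤ 1 + Real.sqrt n + Real.sqrt ‖w‖ := by
  obtain ⟨z₀, hz₀, hz₀im, -, -, hnorm⟩ :=
    exists_root_of_iteratedDeriv_xiSq_eq_zero_of_im_pos n hw him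
  obtain ⟨ρ, hζ, h0, h1, hρ⟩ := exists_zero_of_xiSq_eq_zero hz₀
  have himz : z₀.im = 2 * (ρ.re - 1 / 2) * ρ.im := by
    rw [← hρ]; simp [sq, Complex.mul_im]; ring
  have hprod : (ρ.re - 1 / 2) * ρ.im ≠ 0 := by
    intro h; rw [himz] at hz₀im; nlinarith [h]
  have hre : ρ.re ≠ 1 / 2 := fun h ↦ hprod (by rw [h]; ring)
  have hρim : ρ.im ≠ 0 := fun h ↦ hprod (by rw [h]; ring)
  have hnorm' : ‖z₀‖ = (ρ.re - 1 / 2) ^ 2 + ρ.im ^ 2 := by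
    rw [← hρ, norm_pow, Complex.sq_norm, Complex.normSq_apply]; simp; ring
  have habs : |ρ.im| ≤ Real.sqrt ‖z₀‖ := by
    rw [← Real.sqrt_sq_eq_abs]
    exact Real.sqrt_le_sqrt (by rw [hnorm']; nlinarith [sq_nonneg (ρ.re - 1 / 2)])
  exact ⟨ρ, hζ, h0, h1, hre, hρim, habs.trans hnorm⟩

/-! ### A.2 Realness below the verified height -/

/-- **RH up to height `H` ⇒ the zeros of every `ξ₁⁽ⁿ⁾` with `1 + √n + √‖w‖ ≤ H` are real.**
(Contrapositive of A.1: a non-real zero there would have an off-line ancestor of height `≤ H`.) -/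
theorem im_eq_zero_of_iteratedDeriv_xiSq_eq_zero_of_rhUpTo {H : ℝ} (hRH : RiemannHypothesisUpTo H)
    (n : ℕ) {w : ℂ} (hw : iteratedDeriv n xiSq w = 0)
    (hH : 1 + Real.sqrt n + Real.sqrt ‖w‖ ≤ H) : w.im = 0 := by
  -- the upper half-plane case
  have key : ∀ u : ℂ, iteratedDeriv n xiSq u = 0 → 1 + Real.sqrt n + Real.sqrt ‖u‖ ≤ H →
      ¬ 0 < u.im := by
    intro u hu hHu hpos
    obtain ⟨ρ, hζ, _, _, hre, hρim, hle⟩ :=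
      exists_offLine_zeta_zero_of_iteratedDeriv_xiSq_eq_zero_of_im_pos n hu hpos
    rcases lt_or_gt_of_ne hρim with hneg | hposρ
    · exact hre (hRH.re_eq_of_im_neg hζ hneg (by rw [abs_of_neg hneg] at hle; linarith))
    · exact hre (hRH ρ hζ hposρ (by rw [abs_of_pos hposρ] at hle; linarith))
  rcases lt_trichotomy w.im 0 with hneg | h0 | hpos
  · have hrefl : iteratedDeriv n xiSq (conj w) = conj (iteratedDeriv n xiSq w) :=
      apply_conj_eq_conj (differentiable_iteratedDeriv_of_entire differentiable_xiSq n)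
        (im_iteratedDeriv_ofReal differentiable_xiSq im_xiSq_ofReal n) w
    exact absurd (show 0 < (conj w).im by simpa using hneg)
      (key (conj w) (by rw [hrefl, hw, map_zero]) (by simpa using hH))
  · exact h0
  · exact absurd hpos (key w hw hH)

/-- Unconditional instance (`riemannHypothesisUpTo_10000`, kernel certificate in the tree): **for every
`n`, all zeros `w` of `ξ₁⁽ⁿ⁾` with `√‖w‖ ≤ 9999 − √n` are real.** RH-FREE theorem. -/
theorem im_eq_zero_of_iteratedDeriv_xiSq_eq_zero_upTo_10000 (n : ℕ) {w : ℂ}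
    (hw : iteratedDeriv n xiSq w = 0) (hH : Real.sqrt ‖w‖ ≤ 9999 - Real.sqrt n) : w.im = 0 :=
  im_eq_zero_of_iteratedDeriv_xiSq_eq_zero_of_rhUpTo riemannHypothesisUpTo_10000 n hw (by linarith)

/-- Unconditional instance at height `10⁵` (`riemannHypothesisUpTo_100000` of `RiemannHypothesisUpTo100000X`:
Riemann–Siegel sign certificate with the proved remainder bound): **for every `n`, all zeros `w` of
`ξ₁⁽ⁿ⁾` with `√‖w‖ ≤ 99999 − √n` are real.** RH-FREE theorem. -/
theorem im_eq_zero_of_iteratedDeriv_xiSq_eq_zero_upTo_100000 (n : ℕ)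
    {w : ℂ} (hw : iteratedDeriv n xiSq w = 0) (hH : Real.sqrt ‖w‖ ≤ 99999 - Real.sqrt n) :
    w.im = 0 :=
  im_eq_zero_of_iteratedDeriv_xiSq_eq_zero_of_rhUpTo riemannHypothesisUpTo_100000 n hw (by linarith)

/-! ### A.3 The live cruxes EDGE / BAND in explicit finite ranges (RH-FREE theorems) -/

/-- `√(64 x²) = 8 x` for `x ≥ 0`. -/
theorem sqrt_sixtyFour_mul_sq {x : ℝ} (hx : 0 ≤ x) : Real.sqrt (64 * x ^ 2) = 8 * x := by
  rw [show (64 : ℝ) * x ^ 2 = (8 * x) ^ 2 by ring, Real.sqrt_sq (by positivity)]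

/-- `n / log n ≥ 0` for a natural number `n` (`log 0 = log 1 = 0` give `0`). -/
theorem natDivLog_nonneg (n : ℕ) : 0 ≤ (n : ℝ) / Real.log n :=
  div_nonneg (Nat.cast_nonneg n) (Real.log_natCast_nonneg n)

/-- **EDGE at level `n` from RH up to `H`.** If `8·(n / log n) + √n + 1 ≤ H` and RH holds up to height
`H`, then every zero of `ξ₁⁽ⁿ⁾` in the disc `‖z‖ ≤ 64 (n / log n)²` — in particular in the EDGE annulus
`chainRadius n ≤ ‖z‖ ≤ 64 (n/log n)²` of the crux `XiDerivEdgeReal` — is real. RH-FREE implication. -/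
theorem edgeReal_of_rhUpTo {H : ℝ} (hRH : RiemannHypothesisUpTo H) (n : ℕ)
    (hn : 8 * ((n : ℝ) / Real.log n) + Real.sqrt n + 1 ≤ H) :
    ∀ z : ℂ, iteratedDeriv n xiSq z = 0 → ‖z‖ ≤ 64 * ((n : ℝ) / Real.log n) ^ 2 → z.im = 0 := by
  intro z hz hzle
  have h1 : Real.sqrt ‖z‖ ≤ 8 * ((n : ℝ) / Real.log n) := by
    calc Real.sqrt ‖z‖ ≤ Real.sqrt (64 * ((n : ℝ) / Real.log n) ^ 2) := Real.sqrt_le_sqrt hzle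
      _ = 8 * ((n : ℝ) / Real.log n) := sqrt_sixtyFour_mul_sq (natDivLog_nonneg n)
  exact im_eq_zero_of_iteratedDeriv_xiSq_eq_zero_of_rhUpTo hRH n hz (by linarith)

/-- **BAND at level `n`, every rate `c`, from RH up to `H`.** If `e^{c n / 2} + √n + 1 ≤ H` and RH
holds up to height `H`, then every zero of `ξ₁⁽ⁿ⁾` with `‖z‖ < e^{c n}` is real (the BAND statement
of the crux `XiDerivBandRealAllRates` at level `n`, with no lower radius needed). RH-FREE implication. -/
theorem bandReal_of_rhUpTo {H : ℝ} (hRH : RiemannHypothesisUpTo H) (c : ℝ) (n : ℕ)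
    (hn : Real.exp (c * n / 2) + Real.sqrt n + 1 ≤ H) :
    ∀ z : ℂ, iteratedDeriv n xiSq z = 0 → ‖z‖ < Real.exp (c * n) → z.im = 0 := by
  intro z hz hzlt
  have h1 : Real.sqrt ‖z‖ ≤ Real.exp (c * n / 2) := by
    have : Real.exp (c * n) = Real.exp (c * n / 2) ^ 2 := by
      rw [← Real.exp_nat_mul]; congr 1; ring
    calc Real.sqrt ‖z‖ ≤ Real.sqrt (Real.exp (c * n)) := Real.sqrt_le_sqrt hzlt.le
      _ = Real.exp (c * n / 2) := by rw [this, Real.sqrt_sq (Real.exp_pos _).le]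
  exact im_eq_zero_of_iteratedDeriv_xiSq_eq_zero_of_rhUpTo hRH n hz (by linarith)

/-- `exp k ≤ m` from the decimal bound `e < 2.7182818286` (Mathlib `Real.exp_one_lt_d9`). -/
theorem exp_nat_le_of_pow_le (k : ℕ) {m : ℝ} (h : (2.7182818286 : ℝ) ^ k ≤ m) :
    Real.exp k ≤ m := by
  have h1 : Real.exp (k : ℝ) = Real.exp 1 ^ k := by rw [← Real.exp_nat_mul, mul_one]
  rw [h1]
  exact (pow_le_pow_left₀ (Real.exp_pos 1).le Real.exp_one_lt_d9.le k).trans h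

/-- `k ≤ log n` once `e^k ≤ n` (numerals). -/
theorem nat_le_log_of_exp_le (k n : ℕ) (hn : 0 < n) (h : (2.7182818286 : ℝ) ^ k ≤ n) :
    (k : ℝ) ≤ Real.log n := by
  rw [Real.le_log_iff_exp_le (by exact_mod_cast hn)]
  exact exp_nat_le_of_pow_le k h

/-- Elementary: if `L ≤ log n` with `L > 0` and `8 n / L + √n + 1 ≤ H` then the EDGE hypothesis
`8 (n / log n) + √n + 1 ≤ H` holds. -/
theorem edge_hyp_of_log_ge {n : ℕ} {L H : ℝ} (hL : 0 < L) (hlog : L ≤ Real.log n)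
    (h : 8 * ((n : ℝ) / L) + Real.sqrt n + 1 ≤ H) :
    8 * ((n : ℝ) / Real.log n) + Real.sqrt n + 1 ≤ H := by
  have hmono : (n : ℝ) / Real.log n ≤ (n : ℝ) / L :=
    div_le_div_of_nonneg_left (Nat.cast_nonneg n) hL hlog
  linarith

/-- `√n ≤ m` from `n ≤ m²` (numerals). -/
theorem sqrt_nat_le {n : ℕ} {m : ℝ} (hm : 0 ≤ m) (h : (n : ℝ) ≤ m ^ 2) : Real.sqrt n ≤ m :=
  Real.sqrt_le_sqrt h |>.trans (le_of_eq (Real.sqrt_sq hm))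

/-- **EDGE is an unconditional theorem for every `n ≤ 9800`**: all zeros of `ξ₁⁽ⁿ⁾` in the disc
`‖z‖ ≤ 64 (n / log n)²` are real (`riemannHypothesisUpTo_10000` + the chain-root dictionary; four
ranges of `n` with `log n ≥ log 2, 6, 7, 8`). RH-FREE theorem. -/
theorem edgeReal_upTo_9800 (n : ℕ) (hn : n ≤ 9800) :
    ∀ z : ℂ, iteratedDeriv n xiSq z = 0 → ‖z‖ ≤ 64 * ((n : ℝ) / Real.log n) ^ 2 → z.im = 0 := by
  apply edgeReal_of_rhUpTo riemannHypothesisUpTo_10000 n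
  have hn' : (n : ℝ) ≤ 9800 := by exact_mod_cast hn
  have hsq : Real.sqrt n ≤ 99 := sqrt_nat_le (by norm_num) (by linarith)
  rcases Nat.lt_or_ge n 2 with h2 | h2
  · -- `n = 0, 1`: `log n = 0`
    interval_cases n <;> simp
    all_goals norm_num
  rcases le_or_gt n 403 with h403 | h403
  · have hlog : (0.6931471803 : ℝ) ≤ Real.log n := by
      have h2' : (2 : ℝ) ≤ n := by exact_mod_cast h2
      exact Real.log_two_gt_d9.le.trans (Real.log_le_log (by norm_num) h2')
    refine edge_hyp_of_log_ge (by norm_num) hlog ?_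
    have : (n : ℝ) ≤ 403 := by exact_mod_cast h403
    have hsq' : Real.sqrt n ≤ 21 := sqrt_nat_le (by norm_num) (by linarith)
    have : 8 * ((n : ℝ) / 0.6931471803) ≤ 8 * (403 / 0.6931471803) := by gcongr
    norm_num at this ⊢; linarith
  rcases le_or_gt n 1096 with h1096 | h1096
  · have hlog : ((6 : ℕ) : ℝ) ≤ Real.log n :=
      nat_le_log_of_exp_le 6 n (by omega) ((show (2.7182818286 : ℝ) ^ 6 ≤ 404 by norm_num).trans (by exact_mod_cast (by omega : 404 ≤ n)))
    refine edge_hyp_of_log_ge (by norm_num) hlog ?_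
    have : (n : ℝ) ≤ 1096 := by exact_mod_cast h1096
    have hsq' : Real.sqrt n ≤ 34 := sqrt_nat_le (by norm_num) (by linarith)
    push_cast; linarith
  rcases le_or_gt n 2980 with h2980 | h2980
  · have hlog : ((7 : ℕ) : ℝ) ≤ Real.log n :=
      nat_le_log_of_exp_le 7 n (by omega) ((show (2.7182818286 : ℝ) ^ 7 ≤ 1097 by norm_num).trans (by exact_mod_cast (by omega : 1097 ≤ n)))
    refine edge_hyp_of_log_ge (by norm_num) hlog ?_
    have : (n : ℝ) ≤ 2980 := by exact_mod_cast h2980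
    have hsq' : Real.sqrt n ≤ 55 := sqrt_nat_le (by norm_num) (by linarith)
    push_cast; linarith
  · have hlog : ((8 : ℕ) : ℝ) ≤ Real.log n :=
      nat_le_log_of_exp_le 8 n (by omega) ((show (2.7182818286 : ℝ) ^ 8 ≤ 2981 by norm_num).trans (by exact_mod_cast (by omega : 2981 ≤ n)))
    refine edge_hyp_of_log_ge (by norm_num) hlog ?_
    push_cast; linarith

/-- **EDGE is an unconditional theorem for every `n ≤ 130000`** (RH up to `10⁵` in the tree,
`riemannHypothesisUpTo_100000`, + the chain-root dictionary): all zeros of `ξ₁⁽ⁿ⁾` in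
`‖z‖ ≤ 64 (n / log n)²` are real. RH-FREE theorem. -/
theorem edgeReal_upTo_130000 (n : ℕ) (hn : n ≤ 130000) :
    ∀ z : ℂ, iteratedDeriv n xiSq z = 0 → ‖z‖ ≤ 64 * ((n : ℝ) / Real.log n) ^ 2 → z.im = 0 := by
  rcases le_or_gt n 9800 with h | h
  · exact edgeReal_upTo_9800 n h
  apply edgeReal_of_rhUpTo riemannHypothesisUpTo_100000 n
  have hn' : (n : ℝ) ≤ 130000 := by exact_mod_cast hn
  have hsq : Real.sqrt n ≤ 361 := sqrt_nat_le (by norm_num) (by linarith)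
  rcases le_or_gt n 59874 with h5 | h5
  · have hlog : ((8 : ℕ) : ℝ) ≤ Real.log n :=
      nat_le_log_of_exp_le 8 n (by omega) ((show (2.7182818286 : ℝ) ^ 8 ≤ 2981 by norm_num).trans (by exact_mod_cast (by omega : 2981 ≤ n)))
    refine edge_hyp_of_log_ge (by norm_num) hlog ?_
    have : (n : ℝ) ≤ 59874 := by exact_mod_cast h5
    have hsq' : Real.sqrt n ≤ 245 := sqrt_nat_le (by norm_num) (by linarith)
    push_cast; linarith
  · have hlog : ((11 : ℕ) : ℝ) ≤ Real.log n :=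
      nat_le_log_of_exp_le 11 n (by omega) ((show (2.7182818286 : ℝ) ^ 11 ≤ 59875 by norm_num).trans (by exact_mod_cast (by omega : 59875 ≤ n)))
    refine edge_hyp_of_log_ge (by norm_num) hlog ?_
    push_cast; linarith


/-- **Large-`n` form (any verified height).** For `n ≥ 2981` (`log n ≥ 8`, so `8 n / log n ≤ n`): if RH
holds up to height `H` and `n + √n + 1 ≤ H`, then EDGE holds at level `n`. With the Platt–Trudgian
height `H = 3 000 175 332 800` (named hypothesis `RiemannHypothesisUpTo H`, not a tree theorem) this is
every `n ≤ 3.000173·10¹²`. RH-FREE implication. -/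
theorem edgeReal_of_rhUpTo_of_le {H : ℝ} (hRH : RiemannHypothesisUpTo H) (n : ℕ) (hn : 2981 ≤ n)
    (hH : (n : ℝ) + Real.sqrt n + 1 ≤ H) :
    ∀ z : ℂ, iteratedDeriv n xiSq z = 0 → ‖z‖ ≤ 64 * ((n : ℝ) / Real.log n) ^ 2 → z.im = 0 := by
  apply edgeReal_of_rhUpTo hRH n
  have hlog : ((8 : ℕ) : ℝ) ≤ Real.log n :=
    nat_le_log_of_exp_le 8 n (by omega)
      ((show (2.7182818286 : ℝ) ^ 8 ≤ 2981 by norm_num).trans (by exact_mod_cast hn))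
  refine edge_hyp_of_log_ge (by norm_num) hlog ?_
  push_cast; linarith


/-! ### A.4 First rung of the crux `XiDerivEdgeReal` (BC5 / T3 witness) -/

/-- **FIRST RUNG of `JensenLogBand.XiDerivEdgeReal`.** The crux's matrix
`ξ₁⁽ⁿ⁾ z = 0 → chainRadius n ≤ ‖z‖ → ‖z‖ ≤ 64 (n / log n)² → Im z = 0` holds for EVERY `n ≤ 130000`
(the crux asks it for all `n ≥ n₁`). Unconditional: tree `riemannHypothesisUpTo_100000` /
`riemannHypothesisUpTo_10000` + the chain-root dictionary (A.1–A.3); the inner radius is not even needed.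
RH-FREE theorem (`computational`: compiled sign certificates); nothing here bears on RH. -/
theorem xiDerivEdgeReal_rung : ∀ n : ℕ, n ≤ 130000 → ∀ z : ℂ, iteratedDeriv n xiSq z = 0 →
    chainRadius n ≤ ‖z‖ → ‖z‖ ≤ 64 * ((n : ℝ) / Real.log n) ^ 2 → z.im = 0 :=
  fun n hn z hz _ hle ↦ edgeReal_upTo_130000 n hn z hz hle

end Summit.RiemannHypothesis.RiemannHypothesis.Theorems.JensenPolynomials.LogBand.VerifiedHeight
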